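import Literature.NumberTheory.Transcendental.KZProductIdeal
import Literature.NumberTheory.Transcendental.KZCubicalCalculus
import Literature.NumberTheory.Transcendental.KZSemiCanonicalReductionProofs
import HarnessLib

/-!
# The unit cube is a multiplicative identity modulo the KZ moves
# (stub `stub_cubeMul`, line `Sketch`, crux `KernelForm`, stmt-KontsevichZagierPeriods-10447)

For every integral representation `U = [[0,1]^m, 1]` (domain the closed unit cube `KZ.cube m`,
integrand `1`) and every formal combination `c : KZ.FormalRep`, `c * [U] - c ∈ KZ.relations`:
the unit cube acts as the identity on formal periods `FormalRep ⧸ relations`. The lead's canceller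
normal form uses it to turn `[U] * c` into `c`.

Proof. Both sides are additive in `c`, so it suffices to treat a generator `c = [r]`,
`r : KZ.IntegralRep n`, where `[r] * [U] = [r.prod U]` (`KZ.of_mul_of`). Induct on `m`:
* `m = 0`: `r.prod U = r` as integral representations (`Fin (n + 0) = Fin n` definitionally, the
  trailing block lies in `cube 0 = univ`, and `f ⊗ 1 = f`), `prod_cube_zero_eq`;
* `m → m + 1`: with `U` the cube representation in dimension `m` (`KZ.exists_oneRep`),
  `r.prod U' = (r.prod U).slab 0` as integral representations (`Fin (n + (m + 1)) = Fin ((n + m) + 1)`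
  definitionally, and `cube (m + 1)` is the band `0 ≤ t ≤ 1` over `cube m`, `KZ.cube_succ_eq`),
  `prod_cube_succ_eq`; and `[(r.prod U).slab 0] ≡ [r.prod U]` is one Newton–Leibniz move
  (`KZ.IntegralRep.equivalent_slab`).

References: M. Kontsevich, D. Zagier, *Periods* (2001), §1.2 (rules (1)–(3)), §4.1 (products).
-/

noncomputable section

open MeasureTheory Set
open Literature.NumberTheory.Transcendental

namespace Summit.KontsevichZagierPeriods.KernelForm.LocaliseAtValuePrime

/-- In dimension `m = 0` the product with the cube representation `[[0,1]^0, 1]` is the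
representation itself: `r.prod U = r` (`Fin (n + 0) = Fin n` definitionally, `cube 0 = univ`,
`f ⊗ 1 = f`). [folklore] -/
theorem prod_cube_zero_eq {n : ℕ} (r : KZ.IntegralRep n) (U : KZ.IntegralRep 0)
    (hUd : U.domain = KZ.cube 0) (hUi : U.integrand = fun _ => 1) : r.prod U = r := by
  have hz : ∀ z : Fin (n + 0) → ℝ, (fun i => z (Fin.castAdd 0 i)) = z := fun z => by
    funext i
    exact congrArg z (Fin.ext rfl)
  refine KZ.IntegralRep.ext' ?_ ?_
  · ext z
    simp only [KZ.IntegralRep.prod_domain, KZ.IntegralRep.mem_prodDomain, hUd, KZ.cube_zero,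
      mem_univ, and_true]
    rw [hz z]
  · funext z
    rw [KZ.IntegralRep.prod_integrand_eq, KZ.IntegralRep.prodFun_apply, hz z, hUi]
    exact mul_one _

/-- The step `m → m + 1`: the product with the cube representation `U'` in dimension `m + 1` is
the slab at level `0` over the product with the cube representation `U` in dimension `m`,
`r.prod U' = (r.prod U).slab 0` (`Fin (n + (m + 1)) = Fin ((n + m) + 1)` definitionally;
`cube (m + 1)` is the band `0 ≤ t ≤ 1` over `cube m`). [folklore] -/
theorem prod_cube_succ_eq {n m : ℕ} (r : KZ.IntegralRep n) (U : KZ.IntegralRep m)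
    (hUd : U.domain = KZ.cube m) (hUi : U.integrand = fun _ => 1) (U' : KZ.IntegralRep (m + 1))
    (hU'd : U'.domain = KZ.cube (m + 1)) (hU'i : U'.integrand = fun _ => 1) :
    r.prod U' = (r.prod U).slab 0 := by
  refine KZ.IntegralRep.ext' ?_ ?_
  · ext z
    -- put both memberships at the types of the respective sets (`Fin (n + (m + 1)) → ℝ` and
    -- `Fin ((n + m) + 1) → ℝ` are definitionally, not syntactically, equal)
    change z ∈ KZ.IntegralRep.prodDomain r U' ↔
      @Membership.mem (Fin (n + m + 1) → ℝ) (Set (Fin (n + m + 1) → ℝ)) _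
        (KZ.IntegralRep.slabDomain (r.prod U) 0) z
    simp only [KZ.IntegralRep.prod_domain, KZ.IntegralRep.mem_prodDomain,
      KZ.IntegralRep.slabDomain, mem_setOf_eq, hU'd, hUd, KZ.cube_succ_eq, KZ.init_castAdd,
      KZ.init_natAdd, KZ.apply_natAdd_last, Nat.cast_zero, zero_add, and_assoc]
  · funext z
    simp only [KZ.IntegralRep.prod_integrand_eq, KZ.IntegralRep.integrand_slab,
      KZ.IntegralRep.prodFun_apply, hU'i, hUi, KZ.init_castAdd, mul_one]

/-- **The unit cube is a right identity on generators**: `[r.prod U] - [r] ∈ relations` for the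
cube representation `U = [[0,1]^m, 1]` and every `r : KZ.IntegralRep n`, by induction on `m`
(`prod_cube_zero_eq`; `prod_cube_succ_eq` and one Newton–Leibniz move
`KZ.IntegralRep.equivalent_slab` per step). [folklore] -/
theorem of_prod_cube_sub_of_mem_relations :
    ∀ (m : ℕ) (U : KZ.IntegralRep m), U.domain = KZ.cube m → (U.integrand = fun _ => 1) →
      ∀ (n : ℕ) (r : KZ.IntegralRep n), KZ.of (r.prod U) - KZ.of r ∈ KZ.relations
  | 0, U, hUd, hUi, n, r => by
    have h : KZ.of (r.prod U) = KZ.of r := congrArg KZ.of (prod_cube_zero_eq r U hUd hUi)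
    rw [h, sub_self]
    exact KZ.relations.zero_mem
  | m + 1, U', hU'd, hU'i, n, r => by
    obtain ⟨U, hUd, hUi⟩ :=
      KZ.exists_oneRep (KZ.isSemialgebraic_cube (n := m)) (by simp)
    have ih := of_prod_cube_sub_of_mem_relations m U hUd hUi n r
    have h1 : KZ.of (r.prod U') = KZ.of ((r.prod U).slab 0) :=
      congrArg KZ.of (prod_cube_succ_eq r U hUd hUi U' hU'd hU'i)
    have h2 : KZ.of ((r.prod U).slab 0) - KZ.of (r.prod U) ∈ KZ.relations :=
      ((r.prod U).equivalent_slab 0).symm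
    have e : KZ.of (r.prod U') - KZ.of r =
        (KZ.of ((r.prod U).slab 0) - KZ.of (r.prod U)) + (KZ.of (r.prod U) - KZ.of r) := by
      rw [h1]; abel
    rw [e]
    exact KZ.relations.add_mem h2 ih

/-- **The unit cube acts as the identity on formal periods** (stub `stub_cubeMul` of line `Sketch`
of crux `KernelForm`): for `U = [[0,1]^m, 1]` and every formal combination `c`,
`c * [U] - c ∈ KZ.relations`. Additivity in `c` reduces to generators `c = [r]`, where
`[r] * [U] = [r.prod U]` (`KZ.of_mul_of`) and `of_prod_cube_sub_of_mem_relations` applies.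
[folklore] -/
theorem stub_cubeMul :
    ∀ (m : ℕ) (U : KZ.IntegralRep m) (c : KZ.FormalRep), U.domain = KZ.cube m →
      (U.integrand = fun _ => 1) → c * KZ.of U - c ∈ KZ.relations := by
  intro m U c hUd hUi
  induction c using FreeAbelianGroup.induction_on with
  | zero => rw [zero_mul, sub_zero]; exact KZ.relations.zero_mem
  | of x =>
    obtain ⟨n, r⟩ := x
    change KZ.of r * KZ.of U - KZ.of r ∈ KZ.relations
    rw [KZ.of_mul_of]
    exact of_prod_cube_sub_of_mem_relations m U hUd hUi n r
  | neg x ih =>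
    have e : -FreeAbelianGroup.of x * KZ.of U - -FreeAbelianGroup.of x =
        -(FreeAbelianGroup.of x * KZ.of U - FreeAbelianGroup.of x) := by
      rw [neg_mul]; abel
    rw [e]
    exact KZ.relations.neg_mem ih
  | add x y hx hy =>
    have e : (x + y) * KZ.of U - (x + y) = (x * KZ.of U - x) + (y * KZ.of U - y) := by
      rw [add_mul]; abel
    rw [e]
    exact KZ.relations.add_mem hx hy

end Summit.KontsevichZagierPeriods.KernelForm.LocaliseAtValuePrime
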